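import Summits.BirchSwinnertonDyer.BirchSwinnertonDyer.Theses.EisensteinPrimes
import Summits.BirchSwinnertonDyer.Rank1Residual.X2.CongruenceTransferRankOneSplit
import Summits.BirchSwinnertonDyer.Rank1Residual.X2.IsogenyClassStability
import Literature.NumberTheory.EllipticCurves.TateCurve.NumberFieldUniformization
import Literature.NumberTheory.EllipticCurves.TateCurve.NumberFieldUniformizationTwisted
import Summits.BirchSwinnertonDyer.Rank1Residual.Partition.EisensteinKernelTypeMultiplicative
import Literature.Barriers.BirchSwinnertonDyer.EisensteinMuConjecture
import Literature.NumberTheory.EllipticCurves.GreenbergVatsal2000.CongruentCurves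
import Literature.NumberTheory.EllipticCurves.Rank1Residual.GVParityLineTypeProofs
import HarnessLib

/-!
# Crux `MazurMCOnCellB` (stmt-BirchSwinnertonDyer-19033), line `mudescent`, stub
# `stub_analyticMuZero_offLocus`: the CONGRUENCE ROAD — its kernel-checkable obstruction and its
# typed reduction (cell `bsd-eis`, seat `bsd-eis-mu-c`, PROGRAMME PART 1b seat (3); a
# NEGATIVE-expected probe — this file closes NO stub)

The open stub of line `mudescent` (ky g7, skeleton `bcae135b…`) reads
`X2.CellB W₀ p → ¬ HasRamifiedOddLineAt W₀ p → X2.AnalyticMuLE W₀ p 0`: the ANALYTIC `μ`-invariant of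
the Mazur–Tate–Teitelbaum `p`-adic `L`-function vanishes at the «étale end» `W₀` of a type-A (`¬ GVPar`)
multiplicative Eisenstein class. The «congruence road» would prove it by TRANSPORT: find `E′` with
`E′[p] ≅ W₀[p]` as `Γ_ℚ`-modules (the tree's `X1.CongruenceTransfer.TorsionIso`, the hypothesis of
Greenberg–Vatsal's Thm. (1.4)) and `μ_an(E′) = 0` known, and move `μ_an = 0` along the congruence.

WHAT IS PRINTED (verbatim, arXiv:math/9906215 = Invent. Math. 142 (2000)): Thm. (1.4) «Assume also
that `E₁[p] ≅ E₂[p]` as Galois modules, and that these are irreducible»; the analytic congruence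
Thm. (3.10) «such that Galois modules `E₁[p]` and `E₂[p]` are irreducible and isomorphic … good
ordinary or multiplicative reduction at `p`»; the reducible analytic theorem (3.12) gives
`μ^anal = 0` only on the branch of characters `χ` with `χ(−1) = −ψ(−1)` (`ψ` the UNRAMIFIED
character; GV p. 32–33: «If `E[p]` is reducible, then `α` is determined by `±1 = −ψ(−1)`. A choice
of sign satisfying one of these conditions is said to be admissible … (see [Vat97], Theorems 1.3
and 2.7)» — the canonical period `Ω^α_f` exists for the admissible sign), which on a type-A class
(`ψ` even) is the sign `−`, the ODD branch, not `L_p(E,T)` (p. 42: «we assume that `ψ` is odd and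
unramified at `p` … In this case, the admissible sign is plus»; Rem. (3.9): for the non-admissible
sign even `Λ`-integrality is open for non-optimal curves, «would follow from a conjecture of
Stevens»); Emerton–Pollack–Weston 2006
Thm. 1 assumes `ρ̄` absolutely irreducible. The tree's transcription
`GreenbergVatsal2000.thm14_mainConjecture_transfer_of_torsionIso` carries `HasIrreducibleModPGaloisRep`
for both curves accordingly.

WHAT THIS FILE PROVES (theorems only; no `def`, no named fact, no `sorry`):
* §1 the barrier locus `HasRamifiedOddLineAt` and reducibility are invariants of the `Γ_ℚ`-module
  `E[p]` (`hasRamifiedOddLineAt_iff_of_torsionIso`, `red_iff_of_torsionIso`); `GVPar` already is, in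
  the tree (`X2.gvPar_iff_of_torsionIso`, route G's «negative bookkeeping», REUSED here).
* §2 STRUCTURE OF THE ÉTALE END: on a type-A curve off the barrier locus every rational `p`-line is
  unramified at `p` AND even (`lineUnramifiedAt_and_lineEven_of_offLocus`), and — given the inertia
  line (hL) of an ordinary/multiplicative `p` — there is EXACTLY ONE rational line
  (`rationalLine_unique_of_offLocus`, `existsUnique_rationalLine_of_offLocus_of_mult`): `W₀[p]` is a
  NON-SPLIT extension of the ramified-odd character `ψ` by the unramified-even `φ`.
* §3 THE CLASS-WIDE OBSTRUCTION (kernel): every congruent partner `E′` (`TorsionIso W₀ E′ p`) of an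
  off-locus X2b curve is again residually REDUCIBLE, of type A (`¬ GVPar`), and off the locus
  (`partner_red_notGVPar_offLocus`); so `E′` is outside the hypotheses of GV Thm. (1.3)
  (`thm13_charIdeal_eq_of_gvPar`, Greenberg Prop. 5.10) AND of GV Thms. (1.4)/(3.10)/EPW (irreducible),
  and the partner TRICHOTOMY at a semistable-ordinary `p` is read off the congruence (tree
  `X2.CongruentPartnerAnomalous`, Tate uniformisation discharged): `E′` multiplicative ⇒ same
  splitness, row A10 again (`partner_mult_split_iff`, `partner_cellB`); `E′` good and `W₀` SPLIT ⇒
  `E′` ANOMALOUS type A = rows A1/A3 (`partner_classX1_of_split`); `E′` good and `W₀` NON-SPLIT ⇒ `E′`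
  a covered (CGS 2025) pair of type A (`partner_covered_typeA_of_not_split`) — CGS gives the main
  conjecture there, never `μ = 0`. No printed theorem supplies `μ_an(E′) = 0` in any of the three
  cases: the road never leaves the open problem.
* §4 THE TYPED REDUCTION: the stub follows from (T) a `TorsionIso`-transfer of analytic `μ = 0` among
  multiplicative reducible pairs — UNPRINTED, entered as an explicit HYPOTHESIS, not as a fact — and
  (S) a supply of one congruent multiplicative partner with `μ_an = 0` per off-locus curve
  (`stub_analyticMuZero_offLocus_of_congruenceRoad`, verbatim the registered signature as conclusion).
* (sequel `EisensteinPrimesMazurMCOnCellBCongruenceRoadNegative.lean`: a transfer principle invariant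
  under `ℚ`-ISOGENY — as any notion reading only `E[p]^{ss}` / the `a_ℓ (mod p)` would be — contradicts
  the stub at every off-locus X2b curve, relative to Greenberg's Prop. 5.7 and Wuthrich's Thm. 16; so
  (T) must see the extension class of `E[p]`, which Vatsal's canonical-period argument does not supply
  for the `+` sign at a type-A Eisenstein maximal ideal.)

HONEST FRAMING: a PROBE. Nothing here proves or refutes `stub_analyticMuZero_offLocus`; §4 is a
conditional composition whose hypothesis (T) is not in print. References: [GreenbergVatsal2000] Thms. (1.3), (1.4), (3.10)–(3.12), Prop. (3.7), §2 p. 28;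
[Vatsal1999] Thms. 1.3, 2.7, 2.10 (as cited by GV pp. 33, 43); [EmertonPollackWeston2006] Thm. 1; [GreenbergLNM1716] Prop. 5.7, Conj. 1.11;
[Wuthrich2014] Thm. 16; [Schneider1987MuIsogenies]; [PerrinRiou1989Isogenie]; HOME
`run/shared/lean/pub/bsd-eis/mu-c-MEMO-1.md`.
-/

set_option autoImplicit false

-- `Summit.BirchSwinnertonDyer.BirchSwinnertonDyer.…`: the summit and its single sub-problem share a name (D-0017 layout).
set_option linter.dupNamespace false

noncomputable section

open scoped Classical

open WeierstrassCurve NumberField IsDedekindDomain Field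
  Literature.NumberTheory.EllipticCurves
  Literature.NumberTheory.EllipticCurves.Rank1Residual
  Literature.NumberTheory.GaloisRepresentations
  Literature.Barriers.BirchSwinnertonDyer
  Summit.BirchSwinnertonDyer.Rank1Residual
  Summit.BirchSwinnertonDyer.Rank1Residual.X1.CongruenceTransfer

namespace Summit.BirchSwinnertonDyer.BirchSwinnertonDyer.Theorems.EisensteinPrimesMazurMCOnCellBCongruenceRoad

variable {W W' : WeierstrassCurve ℚ} {p : ℕ} [hp : Fact p.Prime]

/-! ## §1 `E[p] ≅ E′[p]` transports the barrier locus and reducibility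

The transport of `IsRationalLine` / `LineUnramifiedAt` / `LineEven` / `LineOdd` and of `GVPar` along a
`Γ_ℚ`-isomorphism is ALREADY in the tree (`Rank1Residual.isRationalLine_map`, `lineUnramifiedAt_map`,
`not_lineUnramifiedAt_map`, `lineEven_map`, `lineOdd_map`, `gvPar_of_map_injOn`;
`X2.CongruentPartnerAnomalous.isRationalLine_map_equiv`; `X2.gvPar_iff_of_torsionIso`) and is REUSED,
not restated; this section adds the two invariants the road needs beyond `GVPar`. -/

/-- **The barrier locus passes along `E[p] ≅ E′[p]`**: a ramified-odd rational line is mapped to one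
(tree transport lemmas `isRationalLine_map_equiv`, `not_lineUnramifiedAt_map`, `lineOdd_map`).
[cite: GreenbergLNM1716, Prop. 5.7 (p. 113)] -/
theorem hasRamifiedOddLineAt_of_torsionIso (h : TorsionIso W W' p) (hW : HasRamifiedOddLineAt W p) :
    HasRamifiedOddLineAt W' p := by
  obtain ⟨e, he⟩ := h
  obtain ⟨Φ, hΦ, hr, ho⟩ := hW
  exact ⟨Φ.map e.toAddMonoidHom, X2.CongruentPartnerAnomalous.isRationalLine_map_equiv e he hΦ,
    not_lineUnramifiedAt_map e.toAddMonoidHom he (fun P _ hP ↦ e.injective (by simpa using hP)) hΦ hr,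
    lineOdd_map e.toAddMonoidHom he ho⟩

/-- **The barrier locus `HasRamifiedOddLineAt` is an invariant of the `Γ_ℚ`-module `E[p]`.**
[cite: GreenbergLNM1716, Prop. 5.7 (p. 113)] -/
theorem hasRamifiedOddLineAt_iff_of_torsionIso (h : TorsionIso W W' p) :
    HasRamifiedOddLineAt W p ↔ HasRamifiedOddLineAt W' p :=
  ⟨hasRamifiedOddLineAt_of_torsionIso h, hasRamifiedOddLineAt_of_torsionIso h.symm⟩

omit hp in
/-- **Reducibility of `E[p]` is an invariant of the `Γ_ℚ`-module `E[p]`** (both directions of the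
tree's `GreenbergVatsal2000.hasIrreducibleModPGaloisRep_of_torsionIso`). [folklore] -/
theorem red_iff_of_torsionIso [Fact p.Prime] (h : TorsionIso W W' p) :
    ¬ W.HasIrreducibleModPGaloisRep p ↔ ¬ W'.HasIrreducibleModPGaloisRep p := by
  obtain ⟨e, he⟩ := h
  obtain ⟨e', he'⟩ := (show TorsionIso W W' p from ⟨e, he⟩).symm
  exact ⟨fun hW hW' ↦ hW (GreenbergVatsal2000.hasIrreducibleModPGaloisRep_of_torsionIso e' he' hW'),
    fun hW' hW ↦ hW' (GreenbergVatsal2000.hasIrreducibleModPGaloisRep_of_torsionIso e he hW)⟩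

/-! ## §2 The étale end: all rational lines unramified-even, and there is exactly one -/

omit hp in
/-- **Off the locus on a type-A curve every rational `p`-line is unramified at `p` AND even.** On a
curve with `¬ GVPar` every rational line is (unramified ∧ even) ∨ (ramified ∧ odd)
(`coType_of_not_gvPar`); the second kind is the barrier locus. No reduction hypothesis. [folklore] -/
theorem lineUnramifiedAt_and_lineEven_of_offLocus [Fact p.Prime] (hA : ¬ GVPar W p)
    (hoff : ¬ HasRamifiedOddLineAt W p) {Φ : AddSubgroup (geomTorsion W (p : ℤ))}
    (hΦ : IsRationalLine W p Φ) : LineUnramifiedAt W p Φ ∧ LineEven W p Φ := by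
  rcases coType_of_not_gvPar hΦ hA with h | ⟨hr, ho⟩
  · exact h
  · exact absurd ⟨Φ, hΦ, hr, ho⟩ hoff

/-- **The étale end has exactly one rational `p`-line** (given the inertia line (hL) of an ordinary or
multiplicative odd `p`): two distinct rational lines would span `E[p]` and both be unramified, so the
moving inertia element of (hL) would fix `E[p]`. Hence `W₀[p]` is a NON-SPLIT extension (of the
ramified-odd quotient character by the unramified-even sub). [cite: GreenbergVatsal2000, §2 p. 28] -/
theorem rationalLine_unique_of_offLocus [W.IsElliptic]
    (hL : ∀ (v : HeightOneSpectrum (𝓞 ℚ)), (p : 𝓞 ℚ) ∈ v.asIdeal → ∀ 𝔓 ∈ v.primesAbove,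
      ∃ L : AddSubgroup (geomTorsion W (p : ℤ)), Nat.card L = p ∧
        (∀ σ ∈ 𝔓.inertia (absoluteGaloisGroup ℚ), ∀ P : geomTorsion W (p : ℤ), σ • P - P ∈ L) ∧
        (∃ σ ∈ 𝔓.inertia (absoluteGaloisGroup ℚ), ∃ P ∈ L, σ • P ≠ P))
    (hA : ¬ GVPar W p) (hoff : ¬ HasRamifiedOddLineAt W p)
    {Φ₁ Φ₂ : AddSubgroup (geomTorsion W (p : ℤ))} (hΦ₁ : IsRationalLine W p Φ₁)
    (hΦ₂ : IsRationalLine W p Φ₂) : Φ₁ = Φ₂ := by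
  by_contra hne
  have htop : Φ₁ ⊔ Φ₂ = ⊤ :=
    sup_eq_top_of_ne (Rank1Residual.natCard_geomTorsion W p) hΦ₁.1 hΦ₂.1 hne
  obtain ⟨v, hv⟩ :=
    Literature.NumberTheory.NumberFields.RingOfIntegers.exists_heightOneSpectrum_natCast_mem ℚ hp.out
  obtain ⟨𝔓, h𝔓⟩ := HeightOneSpectrum.primesAbove_nonempty v
  obtain ⟨L, -, -, σ₀, hσ₀, x₀, -, hx₀ne⟩ := hL v hv 𝔓 h𝔓
  have hu₁ := (lineUnramifiedAt_and_lineEven_of_offLocus hA hoff hΦ₁).1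
  have hu₂ := (lineUnramifiedAt_and_lineEven_of_offLocus hA hoff hΦ₂).1
  exact hx₀ne (smul_eq_self_of_sup_eq_top htop (hu₁ v hv 𝔓 h𝔓 σ₀ hσ₀)
    (hu₂ v hv 𝔓 h𝔓 σ₀ hσ₀) x₀)

/-- **At an odd MULTIPLICATIVE Eisenstein prime the étale end has exactly one rational `p`-line**
((hL) = the Tate-free inertia line `KernelDisc.exists_inertiaLine_of_mult`). In particular `W₀[p]` is
not the direct sum of two stable lines: the `TorsionIso` class of `W₀` is a NON-ZERO extension class,
invisible to `E[p]^{ss}` / to the `a_ℓ (mod p)`. [cite: GreenbergVatsal2000, §2 pp. 14–15 and p. 28] -/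
theorem existsUnique_rationalLine_of_offLocus_of_mult [W.IsElliptic] [W.IsGloballyMinimal]
    (hp2 : p ≠ 2) (hmult : W.HasMultiplicativeReductionAtPrime p)
    (hred : ¬ W.HasIrreducibleModPGaloisRep p) (hA : ¬ GVPar W p)
    (hoff : ¬ HasRamifiedOddLineAt W p) :
    ∃! Φ : AddSubgroup (geomTorsion W (p : ℤ)), IsRationalLine W p Φ := by
  obtain ⟨Φ, hΦ⟩ := exists_isRationalLine_of_not_irr W p hred
  exact ⟨Φ, hΦ, fun Ψ hΨ ↦ rationalLine_unique_of_offLocus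
    (KernelDisc.exists_inertiaLine_of_mult W p hp2 hmult) hA hoff hΨ hΦ⟩

/-- **The same at a GOOD ORDINARY Eisenstein prime** ((hL) = Serre's ordinary line
`exists_ordinaryLine_of_not_dvd_frobeniusTrace`) — the crux-5 (`MazurMCOnX1RankZero`) twin.
[cite: SerreInventiones1972, §1.11 Prop. 11 and Cor.] -/
theorem existsUnique_rationalLine_of_offLocus_of_goodOrd [W.IsElliptic] [W.IsGloballyMinimal]
    (hp2 : p ≠ 2) (hgood : W.HasGoodReductionAtPrime p) (hord : ¬ (p : ℤ) ∣ W.frobeniusTrace p)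
    (hred : ¬ W.HasIrreducibleModPGaloisRep p) (hA : ¬ GVPar W p)
    (hoff : ¬ HasRamifiedOddLineAt W p) :
    ∃! Φ : AddSubgroup (geomTorsion W (p : ℤ)), IsRationalLine W p Φ := by
  obtain ⟨Φ, hΦ⟩ := exists_isRationalLine_of_not_irr W p hred
  exact ⟨Φ, hΦ, fun Ψ hΨ ↦ rationalLine_unique_of_offLocus
    (exists_ordinaryLine_of_not_dvd_frobeniusTrace W hp2 hgood hord) hA hoff hΨ hΦ⟩

/-! ## §3 The obstruction: a congruent partner of the étale end lies in the same open cell -/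

/-- **Every congruent partner of an off-locus X2b curve is again a reducible, type-A, off-locus
Eisenstein curve.** For `W₀` with `X2.CellB W₀ p` and `¬ HasRamifiedOddLineAt W₀ p`, and ANY `W′`
with `W₀[p] ≅ W′[p]` (`TorsionIso`): `W′[p]` is reducible — so Greenberg–Vatsal's Thm. (1.4) / (3.10)
and Emerton–Pollack–Weston's Thm. 1 («irreducible») do not apply to the pair, the tree's
`thm14_mainConjecture_transfer_of_torsionIso` asking `HasIrreducibleModPGaloisRep` —, `¬ GVPar W′ p` —
so Greenberg–Vatsal's Thm. (1.3) / Greenberg's Prop. 5.10 (`thm13_charIdeal_eq_of_gvPar`,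
`prop510_isTorsion_hasUnitContent_of_gvPar`) do not apply to the partner —, and `W′` is off the
barrier locus (its own `μ = 0` is the same open conjecture, Greenberg Conj. 1.11 / Stevens).
[cite: GreenbergVatsal2000, Thm. (1.4) and Thm. (3.10) («irreducible and isomorphic»), Thm. (1.3)]
[cite: EmertonPollackWeston2006, Thm. 1 (standing hypothesis: ρ̄ absolutely irreducible)] -/
theorem partner_red_notGVPar_offLocus [W.IsElliptic] [W.IsGloballyMinimal]
    (hc : X2.CellB W p) (hoff : ¬ HasRamifiedOddLineAt W p) (hiso : TorsionIso W W' p) :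
    ¬ W'.HasIrreducibleModPGaloisRep p ∧ ¬ GVPar W' p ∧ ¬ HasRamifiedOddLineAt W' p :=
  ⟨(red_iff_of_torsionIso hiso).mp hc.2.1.2.1, X2.not_gvPar_of_torsionIso_of_not_gvPar hiso hc.2.2,
    fun h ↦ hoff ((hasRamifiedOddLineAt_iff_of_torsionIso hiso).mpr h)⟩

/-- **A congruent partner that is itself an X2 pair of analytic rank `0` lies in the SAME open cell
`X2.CellB`** (row A10 again): the congruence road is closed inside the crux's own cell.
[cite: GreenbergVatsal2000, Thm. (1.3) (hypothesis on Φ)] -/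
theorem partner_cellB [W.IsElliptic] [W.IsGloballyMinimal]
    (hc : X2.CellB W p) (hoff : ¬ HasRamifiedOddLineAt W p) (hiso : TorsionIso W W' p)
    (hmult' : W'.HasMultiplicativeReductionAtPrime p) (hr' : W'.analyticRank = 0) :
    X2.CellB W' p ∧ ¬ HasRamifiedOddLineAt W' p := by
  obtain ⟨hred', hA', hoff'⟩ := partner_red_notGVPar_offLocus hc hoff hiso
  exact ⟨⟨hr', ⟨hc.2.1.1, hred', hmult'⟩, hA'⟩, hoff'⟩

/-- **A congruent partner with GOOD anomalous reduction at `p` lies in the open cell `ClassX1`**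
(rows A1/A3: `E[p]` reducible, `p` good, `a_p ≡ 1`, and not (`r = 0 ∧ GVPar`) — indeed `¬ GVPar`):
the other open Eisenstein cell of the route, again outside every printed `μ = 0` theorem.
[cite: GreenbergVatsal2000, p. 5 («if E is a quadratic twist of J by an even character, we can prove very little»)] -/
theorem partner_classX1 [W.IsElliptic] [W.IsGloballyMinimal] [W'.IsGloballyMinimal]
    (hc : X2.CellB W p) (hoff : ¬ HasRamifiedOddLineAt W p) (hiso : TorsionIso W W' p)
    (hgood' : W'.HasGoodReductionAtPrime p) (hanom' : (p : ℤ) ∣ W'.frobeniusTrace p - 1) :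
    ClassX1 W' p ∧ ¬ HasRamifiedOddLineAt W' p := by
  obtain ⟨hred', hA', hoff'⟩ := partner_red_notGVPar_offLocus hc hoff hiso
  have hp2 : p ≠ 2 := hc.2.1.1
  have h2 : 2 < p := lt_of_le_of_ne hp.out.two_le (Ne.symm hp2)
  exact ⟨⟨h2, hred', hgood', ⟨hred', hgood', hanom'⟩, fun h ↦ hA' h.2⟩, hoff'⟩

/-- **SPLIT `p`: every GOOD congruent partner of an off-locus X2b curve is an ANOMALOUS type-A pair of
the open cell `ClassX1`** (rows A1/A3) — the anomaly `p ∣ a_p(W′) − 1` is READ OFF the congruence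
(tree: `X2.CongruentPartnerAnomalous.dvd_frobeniusTrace_sub_one_of_torsionIso_of_split`, Tate
uniformisation A40 discharged), so here `partner_classX1` needs no `a_p` hypothesis. GV's (1.3) and
CGS 2025 Thm. A (`a_p ≢ 1`) are both silent on `W′`.
[cite: GreenbergVatsal2000, Thm. (1.4) and §2 pp. 14–15] [cite: CastellaGrossiSkinner2025, Thm. A (hypothesis on φ)] -/
theorem partner_classX1_of_split [W.IsElliptic] [W.IsGloballyMinimal] [W'.IsElliptic]
    [W'.IsGloballyMinimal]
    (hc : X2.CellB W p) (hoff : ¬ HasRamifiedOddLineAt W p) (hiso : TorsionIso W W' p)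
    (hsplit : W.HasSplitMultiplicativeReductionAtPrime p) (hgood' : W'.HasGoodReductionAtPrime p) :
    ClassX1 W' p ∧ ¬ GVPar W' p ∧ ¬ HasRamifiedOddLineAt W' p := by
  have hanom' : (p : ℤ) ∣ W'.frobeniusTrace p - 1 :=
    X2.CongruentPartnerAnomalous.dvd_frobeniusTrace_sub_one_of_torsionIso_of_split
      TateCurve.Silverman1994_thmV53_tateUniformisation_holds hc.2.1.1 hsplit hc.2.1.2.1 hgood' hiso
  obtain ⟨hX1, hoff'⟩ := partner_classX1 hc hoff hiso hgood' hanom'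
  exact ⟨hX1, (partner_red_notGVPar_offLocus hc hoff hiso).2.1, hoff'⟩

/-- **NON-SPLIT `p`: every GOOD congruent partner of an off-locus X2b curve is a «covered» pair of
TYPE A** — reducible, good ordinary, NON-anomalous (tree:
`X2.CongruentPartnerAnomalous.covered_partner_of_torsionIso_of_not_split`, A41 discharged), hence in
the domain of Castella–Grossi–Skinner 2025 Thm. A (Mazur's main conjecture at `W′` «regardless of the
value of the μ-invariant», modulo the cell's [BST] flag) — which determines NO `μ`; and `¬ GVPar W′ p`,
so Greenberg–Vatsal's `μ = 0` theorem (1.3) is silent too (GV p. 5: «if E is a quadratic twist of J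
by an even character, we can prove very little»). The best partner the road can reach still has no
printed `μ_an = 0`. [cite: CastellaGrossiSkinner2025, Thm. A and Introduction p. 2]
[cite: GreenbergVatsal2000, p. 5 and Thm. (1.3)] -/
theorem partner_covered_typeA_of_not_split [W.IsElliptic] [W.IsGloballyMinimal] [W'.IsElliptic]
    [W'.IsGloballyMinimal]
    (hc : X2.CellB W p) (hoff : ¬ HasRamifiedOddLineAt W p) (hiso : TorsionIso W W' p)
    (hns : ¬ W.HasSplitMultiplicativeReductionAtPrime p) (hgood' : W'.HasGoodReductionAtPrime p) :
    (¬ W'.HasIrreducibleModPGaloisRep p ∧ ¬ (p : ℤ) ∣ W'.frobeniusTrace p ∧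
        ¬ (p : ℤ) ∣ W'.frobeniusTrace p - 1) ∧ ¬ GVPar W' p ∧ ¬ HasRamifiedOddLineAt W' p := by
  obtain ⟨-, hA', hoff'⟩ := partner_red_notGVPar_offLocus hc hoff hiso
  exact ⟨X2.CongruentPartnerAnomalous.covered_partner_of_torsionIso_of_not_split
      TateCurve.Silverman1994_thmV53_corV54_tateUniformisation_holds hc.2.1.1 hc.2.1.2.2 hns hc.2.1.2.1
      hgood' hiso, hA', hoff'⟩

/-- **MULTIPLICATIVE partner: same splitness, same open cell.** A congruent partner `W′` that is
itself multiplicative at `p` is split iff `W₀` is (tree: `split_iff_split_of_torsionIso`), reducible,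
type A and off the locus; with `r_an(W′) = 0` it is an X2b pair again (`partner_cellB`). Together with
`partner_classX1_of_split` / `partner_covered_typeA_of_not_split` this is the partner TRICHOTOMY at a
semistable-ordinary `p`: (mult) row A10 again · (good, `W₀` split) rows A1/A3 · (good, `W₀` non-split)
the covered type-A cell — none with a printed `μ_an = 0`.
[cite: GreenbergVatsal2000, Thm. (1.4) and §2 pp. 14–15] -/
theorem partner_mult_split_iff [W.IsElliptic] [W.IsGloballyMinimal] [W'.IsElliptic]
    [W'.IsGloballyMinimal]
    (hc : X2.CellB W p) (hoff : ¬ HasRamifiedOddLineAt W p) (hiso : TorsionIso W W' p)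
    (hmult' : W'.HasMultiplicativeReductionAtPrime p) :
    (W.HasSplitMultiplicativeReductionAtPrime p ↔ W'.HasSplitMultiplicativeReductionAtPrime p) ∧
      ¬ W'.HasIrreducibleModPGaloisRep p ∧ ¬ GVPar W' p ∧ ¬ HasRamifiedOddLineAt W' p :=
  ⟨X2.CongruentPartnerAnomalous.split_iff_split_of_torsionIso
      TateCurve.Silverman1994_thmV53_corV54_tateUniformisation_holds
      TateCurve.Silverman1994_thmV53_tateUniformisation_holds hc.2.1.1 hc.2.1.2.2 hmult' hc.2.1.2.1 hiso,
    partner_red_notGVPar_offLocus hc hoff hiso⟩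

/-! ## §4 The typed reduction: stub ⇐ (T) `TorsionIso`-transfer of `μ_an = 0` ∧ (S) partner supply -/

/-- **The congruence road, typed (pointwise).** IF (T) analytic `μ = 0` passes from `W′` to `W` along
`W[p] ≅ W′[p]` for multiplicative reducible pairs — an UNPRINTED statement (Greenberg–Vatsal's Thm.
(3.10) is its irreducible case; at a reducible `𝔪` the canonical period exists for the admissible
sign `−ψ(−1)` only, GV p. 32–33 after [Vat97] Thms. 1.3/2.7, i.e. `−` on type A), entered
here as a HYPOTHESIS and not as a fact — and (S) the off-locus X2b curve `W₀` has a congruent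
multiplicative partner with `μ_an = 0`, THEN `X2.AnalyticMuLE W₀ p 0`. By §3 the partner in (S) is a
reducible type-A off-locus curve, for which `μ_an = 0` is in print for NO class (per pair it is the
cell's two-engine certificate — and then certifying `W₀` itself is the same work).
[cite: GreenbergVatsal2000, Thm. (3.10), Thm. (3.12) and pp. 32–33 (admissible sign), Rem. (3.9)] -/
theorem analyticMuLE_zero_of_torsionIsoTransfer_of_partner [W.IsElliptic] [W.IsGloballyMinimal]
    (hT : ∀ (V V' : WeierstrassCurve ℚ) [V.IsElliptic] [V.IsGloballyMinimal] [V'.IsElliptic]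
        [V'.IsGloballyMinimal], V.HasMultiplicativeReductionAtPrime p →
        ¬ V.HasIrreducibleModPGaloisRep p → TorsionIso V V' p →
        V'.HasMultiplicativeReductionAtPrime p → X2.AnalyticMuLE V' p 0 → X2.AnalyticMuLE V p 0)
    (hc : X2.CellB W p)
    (hS : ∃ (W' : WeierstrassCurve ℚ) (_ : W'.IsElliptic) (_ : W'.IsGloballyMinimal),
        TorsionIso W W' p ∧ W'.HasMultiplicativeReductionAtPrime p ∧ X2.AnalyticMuLE W' p 0) :
    X2.AnalyticMuLE W p 0 := by
  obtain ⟨W', _, _, hiso, hmult', hμ'⟩ := hS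
  exact hT W W' hc.2.1.2.2 hc.2.1.2.1 hiso hmult' hμ'

/-- **The congruence road, typed (class-wide): EXACTLY the registered stub signature as conclusion.**
`stub_analyticMuZero_offLocus` of line `mudescent` on stmt-…-19033 follows from (T) the
`TorsionIso`-transfer of analytic `μ = 0` at multiplicative reducible primes (UNPRINTED; hypothesis)
and (S) a congruent multiplicative `μ_an = 0` partner for every off-locus X2b curve (by §3 a curve of
the same open cell; no printed supply). This is the precise residue of the road; it closes nothing.
[cite: GreenbergVatsal2000, Thm. (1.4), Thm. (3.10)] -/
theorem stub_analyticMuZero_offLocus_of_congruenceRoad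
    (hT : ∀ (p : ℕ) [Fact p.Prime] (V V' : WeierstrassCurve ℚ) [V.IsElliptic] [V.IsGloballyMinimal]
        [V'.IsElliptic] [V'.IsGloballyMinimal], V.HasMultiplicativeReductionAtPrime p →
        ¬ V.HasIrreducibleModPGaloisRep p → TorsionIso V V' p →
        V'.HasMultiplicativeReductionAtPrime p → X2.AnalyticMuLE V' p 0 → X2.AnalyticMuLE V p 0)
    (hS : ∀ (W₀ : WeierstrassCurve ℚ) [W₀.IsElliptic] [W₀.IsGloballyMinimal] (p : ℕ) [Fact p.Prime],
        X2.CellB W₀ p → ¬ HasRamifiedOddLineAt W₀ p →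
        ∃ (W' : WeierstrassCurve ℚ) (_ : W'.IsElliptic) (_ : W'.IsGloballyMinimal),
          TorsionIso W₀ W' p ∧ W'.HasMultiplicativeReductionAtPrime p ∧ X2.AnalyticMuLE W' p 0) :
    ∀ (W₀ : WeierstrassCurve ℚ) [W₀.IsElliptic] [W₀.IsGloballyMinimal] (p : ℕ) [Fact p.Prime],
      X2.CellB W₀ p → ¬ HasRamifiedOddLineAt W₀ p → X2.AnalyticMuLE W₀ p 0 :=
  fun W₀ _ _ p _ hc hoff ↦
    analyticMuLE_zero_of_torsionIsoTransfer_of_partner (hT p) hc (hS W₀ p hc hoff)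

end Summit.BirchSwinnertonDyer.BirchSwinnertonDyer.Theorems.EisensteinPrimesMazurMCOnCellBCongruenceRoad

end
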